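import Literature.MathematicalPhysics.QuantumLattice.HubbardModelThermodynamicLimitProofs
import Literature.MathematicalPhysics.QuantumLattice.DWaveSourceProofs
import Literature.MathematicalPhysics.QuantumLattice.TraceInequalitiesProofs
import Literature.MathematicalPhysics.QuantumLattice.FinDimSpectrumProofs

/-!
# Route `DeformationLadder`, item `ApproximatingHamiltonianGC` (stmt-HubbardSuperconductivity-1895):
# pair-sourced Hubbard Hamiltonians — hermiticity, expectation values, pair amplitudes of product vectors

Support file (`--supports stmt-HubbardSuperconductivity-1895`). Towards the thermodynamic limit of
the `d`-wave SOURCE energy densities `E₀(dWaveSourceTorus L U μ h)/L²` (the hypothesis of the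
reduction `approximatingHamiltonianGC_of_sourceLimit`), we consider Hamiltonians of the form
`H_{G,W} = hamiltonianWith G t U μ − Σ_{p,q} W(p,q) (b_{pq} + b_{pq}ᴴ)`,
`b_{pq} = c_{p↑}c_{q↓} − c_{p↓}c_{q↑}` the singlet bond pair (`bondPair`), for a real pair weight
`W` on ordered pairs of sites: the Hubbard Hamiltonian with an arbitrary finite-range pair source
(the torus model `dWaveSourceTorus` is of this form). This file collects the elementary inputs of
the sub-additivity (cut) estimate proved in the companion file `…SourcedCut.lean`:

* `dlsc_isHermitian_sourced` (hermiticity), `dlsc_dotProduct_sourced_mulVec` (the expectation in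
  a Fock vector: hopping amplitudes `⟨c_{pσ}ψ, c_{qσ}ψ⟩`, densities, pair amplitudes `⟨ψ, b_{pq}ψ⟩`),
  the a priori bounds `|Σ_σ⟨c_{pσ}ψ,c_{qσ}ψ⟩| ≤ 2`, `|⟨ψ, b_{pq}ψ⟩| ≤ 2` for unit `ψ`;
* `dlsc_dotProduct_pair_low/high`: in the graded tensor product `Ψ = ψ₁ ⊗ ψ₂` of the tree's
  toolkit (`HubbardModelThermodynamicLimitProofs`), pair annihilation inside a block factorises,
  `⟨Ψ, c_{fa}c_{fa'}Ψ⟩ = ⟨ψ₁, c_ac_{a'}ψ₁⟩⟨ψ₂,ψ₂⟩` and `⟨Ψ, c_{gb}c_{gb'}Ψ⟩ = ⟨ψ₁,ψ₁⟩⟨ψ₂, c_bc_{b'}ψ₂⟩`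
  (the two parity twists of the lower block cancel);
* generic: near-minimisers of the Rayleigh quotient (`dlsc_exists_unit_rayleigh_lt`), and
  `‖Σ c_i‖ ≤ kB` when at most `k` terms are non-zero (`dlsc_norm_sum_le_of_card_le`).

Ruelle, *Statistical Mechanics: Rigorous Results* (1969) §2, for lattice fermions with a pair
source. No definitions are introduced.
-/

set_option linter.dupNamespace false

noncomputable section

namespace Summit.HubbardSuperconductivity.HubbardSuperconductivity.Theorems

open Matrix Finset Literature.MathematicalPhysics.QuantumLattice
open Literature.MathematicalPhysics.QuantumLattice.ThermodynamicLimit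
open Literature.Barriers.HubbardSuperconductivity (bondPair bondPair_conjTranspose norm_bondPair_le_two)
open scoped ComplexOrder Matrix.Norms.L2Operator

/-! ### Generic matrix facts -/

/-- `⟨x, Aᴴ x⟩ = conj ⟨x, A x⟩`. [folklore] -/
theorem dlsc_dotProduct_conjTranspose_mulVec {n : Type*} [Fintype n] (A : Matrix n n ℂ)
    (x : n → ℂ) : star x ⬝ᵥ (Aᴴ *ᵥ x) = star (star x ⬝ᵥ (A *ᵥ x)) := by
  rw [mulVec_conjTranspose, star_dotProduct_star, dotProduct_mulVec]

/-- Near-minimisers of the Rayleigh quotient exist: for Hermitian `A` and `E₀(A) < b` there is a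
unit vector with `Re⟨ψ, Aψ⟩ < b` (variational principle `minEnergyOn_top`). [folklore] -/
theorem dlsc_exists_unit_rayleigh_lt {n : Type*} [Fintype n] [DecidableEq n] [Nonempty n]
    {A : Matrix n n ℂ} (hA : A.IsHermitian) {b : ℝ} (hb : A.groundEnergy < b) :
    ∃ ψ : n → ℂ, star ψ ⬝ᵥ ψ = 1 ∧ (star ψ ⬝ᵥ A *ᵥ ψ).re < b := by
  rw [← minEnergyOn_top_holds hA, Matrix.minEnergyOn] at hb
  obtain ⟨i₀⟩ := ‹Nonempty n›
  have hne : {E : ℝ | ∃ ψ ∈ (⊤ : Submodule ℂ (n → ℂ)), star ψ ⬝ᵥ ψ = 1 ∧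
      E = (star ψ ⬝ᵥ A *ᵥ ψ).re}.Nonempty :=
    ⟨_, Pi.single i₀ 1, Submodule.mem_top, by simp, rfl⟩
  obtain ⟨E, ⟨ψ, -, hψ, rfl⟩, hE⟩ := exists_lt_of_csInf_lt hne hb
  exact ⟨ψ, hψ, hE⟩

/-- **Few non-zero terms**: if `c i ≠ 0` only on a set of at most `k` indices (contained in a
decidable `P`) and `‖c i‖ ≤ B` there, then `‖Σ_i c i‖ ≤ k B`. [folklore] -/
theorem dlsc_norm_sum_le_of_card_le {ι : Type*} [Fintype ι] (c : ι → ℂ) (P : ι → Prop)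
    [DecidablePred P] (hP : ∀ i, c i ≠ 0 → P i) {B : ℝ} (hB0 : 0 ≤ B) (hB : ∀ i, P i → ‖c i‖ ≤ B)
    {k : ℕ} (hk : #{i | P i} ≤ k) : ‖∑ i, c i‖ ≤ k * B := by
  rw [← Finset.sum_filter_of_ne (p := P) (fun i _ hi => hP i hi)]
  calc ‖∑ i ∈ Finset.univ.filter P, c i‖ ≤ ∑ i ∈ Finset.univ.filter P, ‖c i‖ := norm_sum_le _ _
    _ ≤ ∑ _i ∈ Finset.univ.filter P, B :=
        Finset.sum_le_sum fun i hi => hB i (Finset.mem_filter.1 hi).2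
    _ ≤ k * B := by
        rw [Finset.sum_const, nsmul_eq_mul]
        exact mul_le_mul_of_nonneg_right (by exact_mod_cast hk) hB0

/-! ### The pair source: hermiticity, expectation, a priori bound -/

section Source

variable {Λ : Type*} [LinearOrder Λ] [Fintype Λ]

/-- The pair source `Σ_{p,q} W(p,q)(b_{pq} + b_{pq}ᴴ)` with real weights is Hermitian. [folklore] -/
theorem dlsc_isHermitian_source (W : Λ → Λ → ℝ) :
    (∑ p : Λ, ∑ q : Λ, ((W p q : ℝ) : ℂ) • (bondPair p q + (bondPair p q)ᴴ)).IsHermitian := by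
  have hterm : ∀ p q : Λ,
      (((W p q : ℝ) : ℂ) • (bondPair p q + (bondPair p q)ᴴ)).IsHermitian := fun p q => by
    refine IsHermitian.smul (isHermitian_add_transpose_self _) ?_
    rw [isSelfAdjoint_iff, Complex.star_def, Complex.conj_ofReal]
  rw [Matrix.IsHermitian, Matrix.conjTranspose_sum]
  refine Finset.sum_congr rfl fun p _ => ?_
  rw [Matrix.conjTranspose_sum]
  exact Finset.sum_congr rfl fun q _ => (hterm p q).eq

variable (G : SimpleGraph Λ) [DecidableRel G.Adj]

/-- The pair-sourced Hubbard Hamiltonian `hamiltonianWith G t U μ − Σ W(b + bᴴ)` is Hermitian.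
[folklore] -/
theorem dlsc_isHermitian_sourced (W : Λ → Λ → ℝ) (t U μ : ℝ) :
    (hamiltonianWith G t U μ -
      ∑ p : Λ, ∑ q : Λ, ((W p q : ℝ) : ℂ) • (bondPair p q + (bondPair p q)ᴴ)).IsHermitian :=
  (isHermitian_hamiltonianWith G t U μ).sub (dlsc_isHermitian_source W)

omit [DecidableRel G.Adj] in
variable {G} in
/-- Expectation of the pair source: `⟨ψ, Σ W(b + bᴴ) ψ⟩ = Σ_{p,q} W(p,q)(⟨ψ,b_{pq}ψ⟩ + conj⟨ψ,b_{pq}ψ⟩)`.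
[folklore] -/
theorem dlsc_dotProduct_source_mulVec (W : Λ → Λ → ℝ) (ψ : Fock (Orb Λ)) :
    star ψ ⬝ᵥ ((∑ p : Λ, ∑ q : Λ, ((W p q : ℝ) : ℂ) • (bondPair p q + (bondPair p q)ᴴ)) *ᵥ ψ) =
      ∑ p : Λ, ∑ q : Λ, ((W p q : ℝ) : ℂ) *
        (star ψ ⬝ᵥ (bondPair p q *ᵥ ψ) + star (star ψ ⬝ᵥ (bondPair p q *ᵥ ψ))) := by
  simp only [Matrix.sum_mulVec, dotProduct_sum, smul_mulVec, dotProduct_smul, add_mulVec,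
    dotProduct_add, smul_eq_mul, dlsc_dotProduct_conjTranspose_mulVec]

/-- Expectation of the particle number: `⟨ψ, N ψ⟩ = Σ_{x,σ} ⟨c_{xσ}ψ, c_{xσ}ψ⟩`. [folklore] -/
theorem dlsc_dotProduct_totalNumber_mulVec (ψ : Fock (Orb Λ)) :
    star ψ ⬝ᵥ ((totalNumber : Matrix (Finset (Orb Λ)) (Finset (Orb Λ)) ℂ) *ᵥ ψ) =
      ∑ x : Λ, ∑ σ : Fin 2, star (annihilation (orb x σ) *ᵥ ψ) ⬝ᵥ (annihilation (orb x σ) *ᵥ ψ) := by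
  simp only [totalNumber, numberOp, Matrix.sum_mulVec, dotProduct_sum,
    dotProduct_creation_mul_annihilation_mulVec]

/-- **Expectation of the pair-sourced Hamiltonian** in a Fock vector: hopping amplitudes, on-site
densities, the chemical-potential term and the pair amplitudes. [folklore] -/
theorem dlsc_dotProduct_sourced_mulVec (W : Λ → Λ → ℝ) (t U μ : ℝ) (ψ : Fock (Orb Λ)) :
    star ψ ⬝ᵥ ((hamiltonianWith G t U μ -
        ∑ p : Λ, ∑ q : Λ, ((W p q : ℝ) : ℂ) • (bondPair p q + (bondPair p q)ᴴ)) *ᵥ ψ) =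
      -(t : ℂ) * ∑ x : Λ, ∑ y : Λ, ∑ σ : Fin 2,
          (if G.Adj x y then star (annihilation (orb x σ) *ᵥ ψ) ⬝ᵥ (annihilation (orb y σ) *ᵥ ψ)
            else 0) +
        (U : ℂ) * ∑ x : Λ, star ψ ⬝ᵥ (numberOp x 0 *ᵥ (numberOp x 1 *ᵥ ψ)) -
        (μ : ℂ) * ∑ x : Λ, ∑ σ : Fin 2,
          star (annihilation (orb x σ) *ᵥ ψ) ⬝ᵥ (annihilation (orb x σ) *ᵥ ψ) -
        ∑ p : Λ, ∑ q : Λ, ((W p q : ℝ) : ℂ) *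
          (star ψ ⬝ᵥ (bondPair p q *ᵥ ψ) + star (star ψ ⬝ᵥ (bondPair p q *ᵥ ψ))) := by
  rw [sub_mulVec, dotProduct_sub, dlsc_dotProduct_source_mulVec, hamiltonianWith_eq, sub_mulVec,
    dotProduct_sub, dotProduct_hamiltonian_mulVec, smul_mulVec, dotProduct_smul,
    dlsc_dotProduct_totalNumber_mulVec, smul_eq_mul]

/-- `|⟨ψ, b_{pq} ψ⟩| ≤ 2` for a unit vector (`‖b_{pq}‖ ≤ 2`). [folklore] -/
theorem dlsc_norm_dotProduct_bondPair_le {ψ : Fock (Orb Λ)} (hψ : star ψ ⬝ᵥ ψ = 1) (p q : Λ) :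
    ‖star ψ ⬝ᵥ (bondPair p q *ᵥ ψ)‖ ≤ 2 := by
  have h := norm_star_dotProduct_mulVec_le (bondPair p q) ψ
  rw [hψ, Complex.one_re, mul_one] at h
  exact h.trans (norm_bondPair_le_two p q)

/-- `|W(⟨ψ,bψ⟩ + conj⟨ψ,bψ⟩)| ≤ 4|W|` for a unit vector. [folklore] -/
theorem dlsc_norm_weight_mul_pairAmp_le {ψ : Fock (Orb Λ)} (hψ : star ψ ⬝ᵥ ψ = 1) (c : ℝ)
    (p q : Λ) :
    ‖((c : ℝ) : ℂ) * (star ψ ⬝ᵥ (bondPair p q *ᵥ ψ) + star (star ψ ⬝ᵥ (bondPair p q *ᵥ ψ)))‖ ≤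
      |c| * 4 := by
  rw [norm_mul, Complex.norm_real, Real.norm_eq_abs]
  refine mul_le_mul_of_nonneg_left ?_ (abs_nonneg c)
  have h := dlsc_norm_dotProduct_bondPair_le hψ p q
  calc _ ≤ ‖star ψ ⬝ᵥ (bondPair p q *ᵥ ψ)‖ + ‖star (star ψ ⬝ᵥ (bondPair p q *ᵥ ψ))‖ :=
        norm_add_le _ _
    _ ≤ 2 + 2 := by rw [norm_star]; exact add_le_add h h
    _ = 4 := by norm_num

/-- `|Σ_σ ⟨c_{pσ}ψ, c_{qσ}ψ⟩| ≤ 2` for a unit vector. [folklore] -/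
theorem dlsc_norm_sum_hopAmp_le {ψ : Fock (Orb Λ)} (hψ : star ψ ⬝ᵥ ψ = 1) (p q : Λ) :
    ‖∑ σ : Fin 2, star (annihilation (orb p σ) *ᵥ ψ) ⬝ᵥ (annihilation (orb q σ) *ᵥ ψ)‖ ≤ 2 := by
  calc _ ≤ ∑ σ : Fin 2, ‖star (annihilation (orb p σ) *ᵥ ψ) ⬝ᵥ (annihilation (orb q σ) *ᵥ ψ)‖ :=
        norm_sum_le _ _
    _ ≤ ∑ _σ : Fin 2, (1 : ℝ) := Finset.sum_le_sum fun σ _ =>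
        norm_dotProduct_annihilation_le_one hψ _ _
    _ = 2 := by simp

end Source

/-! ### Pair amplitudes of product vectors -/

section ProductPairs

variable {α β γ : Type*} [LinearOrder α] [Fintype α] [LinearOrder β] [Fintype β]
  [LinearOrder γ] [Fintype γ] {f : α → γ} {g : β → γ}

/-- Pair annihilation inside the lower block: `⟨Ψ, c_{fa} c_{fa'} Ψ⟩ = ⟨ψ₁, c_a c_{a'} ψ₁⟩ ⟨ψ₂, ψ₂⟩`
for `Ψ = ψ₁ ⊗ ψ₂`. [folklore] -/
theorem dlsc_dotProduct_pair_low (hf : StrictMono f) (hg : StrictMono g)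
    (hfg : ∀ a b, f a < g b) (hcov : ∀ c, (∃ a, f a = c) ∨ ∃ b, g b = c)
    (ψ₁ : Fock α) (ψ₂ : Fock β) (a a' : α) :
    star (fun s : Finset γ => ψ₁ {x | f x ∈ s} * ψ₂ {y | g y ∈ s}) ⬝ᵥ
        ((annihilation (f a) * annihilation (f a')) *ᵥ
          (fun s : Finset γ => ψ₁ {x | f x ∈ s} * ψ₂ {y | g y ∈ s})) =
      (star ψ₁ ⬝ᵥ ((annihilation a * annihilation a') *ᵥ ψ₁)) * (star ψ₂ ⬝ᵥ ψ₂) := by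
  have hne : ∀ a b, f a ≠ g b := fun a b => (hfg a b).ne
  rw [← mulVec_mulVec, annihilation_low_mulVec_prodVec hf hfg hcov,
    annihilation_low_mulVec_prodVec hf hfg hcov (ψ₁ := annihilation a' *ᵥ ψ₁),
    dotProduct_prodVec hf.injective hg.injective hne hcov, ← mulVec_mulVec]

/-- Pair annihilation inside the upper block: `⟨Ψ, c_{gb} c_{gb'} Ψ⟩ = ⟨ψ₁, ψ₁⟩ ⟨ψ₂, c_b c_{b'} ψ₂⟩`
(the two parity twists of the lower block cancel). [folklore] -/
theorem dlsc_dotProduct_pair_high (hf : StrictMono f) (hg : StrictMono g)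
    (hfg : ∀ a b, f a < g b) (hcov : ∀ c, (∃ a, f a = c) ∨ ∃ b, g b = c)
    (ψ₁ : Fock α) (ψ₂ : Fock β) (b b' : β) :
    star (fun s : Finset γ => ψ₁ {x | f x ∈ s} * ψ₂ {y | g y ∈ s}) ⬝ᵥ
        ((annihilation (g b) * annihilation (g b')) *ᵥ
          (fun s : Finset γ => ψ₁ {x | f x ∈ s} * ψ₂ {y | g y ∈ s})) =
      (star ψ₁ ⬝ᵥ ψ₁) * (star ψ₂ ⬝ᵥ ((annihilation b * annihilation b') *ᵥ ψ₂)) := by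
  have hne : ∀ a b, f a ≠ g b := fun a b => (hfg a b).ne
  rw [← mulVec_mulVec, annihilation_high_mulVec_prodVec hf hg hfg hcov,
    annihilation_high_mulVec_prodVec hf hg hfg hcov (ψ₁ := parityOp *ᵥ ψ₁)
      (ψ₂ := annihilation b' *ᵥ ψ₂),
    parityOp_mulVec_parityOp_mulVec, dotProduct_prodVec hf.injective hg.injective hne hcov,
    ← mulVec_mulVec]

end ProductPairs

end Summit.HubbardSuperconductivity.HubbardSuperconductivity.Theorems

end
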